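import Summits.NavierStokesRegularity.NavierStokesRegularity.Theorems.FilamentSkeletonRssSkeletonJ1RSplit
import Summits.NavierStokesRegularity.NavierStokesRegularity.Theorems.FilamentSkeletonRssNormalBlockMatchedL
import Summits.NavierStokesRegularity.NavierStokesRegularity.Theorems.FilamentSkeletonRssClause13RImp
import Summits.NavierStokesRegularity.NavierStokesRegularity.Theorems.FilamentSkeletonRssSkeletonJ1RFrameDefs
import Summits.NavierStokesRegularity.NavierStokesRegularity.Theorems.FilamentSkeletonRssSkeletonJ1RLineDefs
import Summits.NavierStokesRegularity.NavierStokesRegularity.Theorems.FilamentSkeletonRssSkeletonJ1RLiaFrameExists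
import Summits.NavierStokesRegularity.NavierStokesRegularity.Theorems.FilamentSkeletonRssSkeletonJ1RFlatOutput
import Summits.NavierStokesRegularity.NavierStokesRegularity.Theorems.FilamentSkeletonRssSkeletonJ1RReferenceInjectivityOfCore
import Summits.NavierStokesRegularity.NavierStokesRegularity.Theorems.FilamentSkeletonRssSkeletonJ1RLiaDefectB

/-!
# Route `FilamentSkeletonRss` · crux `SkeletonJ1R` (stmt-NavierStokesRegularity-23610) · LINE `streamline_kantorovich_R` — SKELETON OF RECORD
# (registered 2026-08-29 by lead `ns-fsr-lead-23610` g0; authored by crux-strategist cstrat-23610-g2) — NEWTON–KANTOROVICH FOR THE COMPACT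
# STREAMLINE MAP AT FULL SWITCH-ON, ANCHORED AT THE EXPLICIT LIA REFERENCE

v6 (lead g2, RESHAPE 4, steward key dss_191-F): STUB F2 RE-STATED IN RATE-B CURRENCY AND DISCHARGED BY NAME — `stub_liaDefectBL : LiaDefectBL`
(`…SkeletonJ1RLineDefs` §4: `‖swDefect(x) j τ‖ ≤ C_d(√Γ + |τ|)/√(log Γ)`, the cancellation-free rate; PROVED in `…SkeletonJ1RLiaDefectB`, chain
`…LiaSelfSplit/…LiaSelfWindow/…LiaSelfEnvelope/…LiaLipschitzTools/…LiaRefEnvelope/…LiaSelfReference/…LiaPartnerWindow/…LiaPartnerReference/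
…LiaFootGeometry/…LiaDefectSplit/…LiaDefectSelfArith/…LiaDefectSelfBound/…LiaDefectPartnerBound`) replaces `stub_liaDefectL : LiaDefectL`
(RATE A `log log Γ/log Γ`, which needs two oddness lemmas not yet in the tree); consequently stub K is RE-POINTED to `stub_kantorovichClosingBL :
KantorovichClosingBL := LiaFrameExistsL → LiaDefectBL → ReferenceInjectivityL → FineFixedPointL` (the closing consumes the WEAKER defect rate — the
honest, stronger requirement; its first Newton step is `O(Rb³√Γ)` inside the fine tolerance, `h ≍ Rb²/√log Γ → 0`).  `stub_corePinningL` and the 13-R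
stub are byte-identical to v5.  3 `sorry`s left (L-core, K-B, 13R).

v5 (lead g0, RESHAPE 3): STUB L SPLIT — its model-region ("far") part is PROVED (`…SkeletonJ1RFarPinning`, `…SkeletonJ1RReferenceInjectivityOfCore.
referenceInjectivityL_of_core : CorePinningL → ReferenceInjectivityL`, real proofs) and the registered stub is now `stub_corePinningL : CorePinningL`
(`…SkeletonJ1RLineDefs` §3: `ReferenceInjectivityL` restricted to the closed switched region `‖x_j τ‖² ≤ 2ℓ²`); `stub_referenceInjectivityL` is
discharged from it by name.  4 `sorry`s left (F2, L-core, K, 13R).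

v4 (lead g0): STUBS F1 AND D DISCHARGED BY NAME — `Theorems.SkeletonJ1RFrame.stub_liaFrameExistsL` (p718543, `…SkeletonJ1RLiaFrameExists`, lead) and
`Theorems.SkeletonJ1RFrame.stub_flatOutputL` (p717964, `…SkeletonJ1RFlatOutput`, stub-D hand ns-filament-21221-p1 g17); 4 `sorry`s left (F2 L K 13R).

v2 (lead g0, RESHAPE 1): the line's vocabulary and stub statements are now LANDED Defs files and are IMPORTED, not restated —
`Theorems/FilamentSkeletonRssSkeletonJ1RFrameDefs.lean` (objects: `bsField` … `IsLiaReference`, `swDefect`, and §5 the DATUM-SLICED frame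
`SlicedReference` / `SlicedModel` / `SlicedFrame`) and `Theorems/FilamentSkeletonRssSkeletonJ1RLineDefs.lean` (the registered stub statements
`FlatOutputL` (D), `LiaFrameExistsL` (F1), `LiaDefectL` (F2), `ReferenceInjectivityL` (L), `FineFixedPointL`, `KantorovichClosingL` (K)).  The TWO
changes of the reshape: (1) the frame hypothesis of F1 / F2 / L / K / D is the datum-sliced frame (`SlicedFrame`: arm model prescribed on slices
`z ⊥ t_j`, no tube clause) instead of the record's `AdmissibleFrame` (slices `z ⊥ x_j′ τ`, injective normal tubes) — an explicit smooth model exists for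
the former without tubular-neighbourhood calculus, and the sliced streamline dynamics `τ̇ = (7/4)τ`, `ż = −λz` are what K uses; (2) the v1 stub F
`LiaFrameL` (frame existence ∧ defect rate) is SPLIT into F1 `stub_liaFrameExistsL` (M, concrete) and F2 `stub_liaDefectL` (M–L, analytic), K taking
both.  Other stub names and signatures (as strings) are unchanged; line card: `Lines/streamline_kantorovich_R.md`; mechanism summary: v1 header (kept below).

v1 HEADER (cstrat-23610-g2).  Frame, switched field, shadowing classes, regular waist, flat output and the 13-R stub are those of the shelf line
`lia_switchoff_degree_R` (cstrat-23610-0; credited in full) and its frame file (the LIA reference `IsLiaReference`).  WHAT IS NEW is the EXISTENCE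
MECHANISM for the heart `TangentSkeletonNearStraightL` (stmt-23320): not a Leray–Schauder continuation in the switch-on time with an a priori
confinement of ALL switched-tangent skeletons at ALL `s`, but the affine-covariant NEWTON–KANTOROVICH theorem — LANDED as
`Literature.Analysis.Calculus.NewtonKantorovich_holds` — applied ONCE, at `s = 1`, to `G := I − Φ¹` where `Φ¹(X)` is the arclength-parametrised unstable
streamline (from its waist zero) of the switched field generated by `X`.  `Φ¹` gains derivatives, so `DG = I − compact`: NO DERIVATIVE LOSS, and
Kantorovich needs invertibility at ONE explicit point — the LIA reference `x` (stub L) — plus a Lipschitz bound on `DΦ¹` over a ball (stub K), fed by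
the frame and its defect rate (stub F); output bookkeeping (stub D) and 13-R (stub = item 23612) are shared with every line.  Composition (REAL
proofs): `tangentSkeletonNearStraightLS_of` ⟹ `TangentSkeletonNearStraightL` by `Iff.rfl` ⟹ the crux through the LANDED glue `skeletonJ1R_of_children`
(p673130) with the LANDED `NormalBlockMatchedL` (p667604).

MODEL rung, NEGATIVE side of the ladder: a skeleton registration about a HYPOTHETICAL filament-type rotating-self-similar blow-up skeleton;
nothing here proves or refutes any statement about Navier–Stokes regularity.
-/

set_option linter.dupNamespace false
set_option linter.unusedVariables false

noncomputable section

namespace Summit.NavierStokesRegularity.NavierStokesRegularity.Cruxes.SkeletonJ1R.StreamlineKantorovichR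

open Set Function Filter MeasureTheory Real
open Literature.Analysis.FluidPDE
open Summit.NavierStokesRegularity.NavierStokesRegularity.Theses.FilamentSkeletonRss
open Summit.NavierStokesRegularity.NavierStokesRegularity.Theorems.FilamentSkeletonRssSkeletonJ1GSplit
  (NearStraightJ1G StraightDatum straightDatumGP_exists)
open Summit.NavierStokesRegularity.NavierStokesRegularity.Theorems.FilamentSkeletonRssSkeletonJ1LSplit
  (FlatJ1L TangentSkeletonNearStraightLS route_tangentSkeletonNearStraightL_iff)
open Summit.NavierStokesRegularity.NavierStokesRegularity.Theorems.SkeletonJ1RFrame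
open scoped InnerProductSpace Topology BigOperators

/-! ## §1–§3 Vocabulary and stub statements: IMPORTED from `…SkeletonJ1RFrameDefs` / `…SkeletonJ1RLineDefs` (namespace `…Theorems.SkeletonJ1RFrame`) -/

/-! ## §4 The stubs (the ONLY `sorry`s of this file) + the record's 13-R stub BY NAME -/

/-- STUB F1 · `stub_liaFrameExistsL` · DISCHARGED BY NAME: the LIA reference frame exists at `λ = 1` (landed `…SkeletonJ1RLiaFrameExists`:
IVP + near-straightness bootstrap + skew-line geometry + rates + explicit datum-sliced model).  No `sorry`. -/
theorem stub_liaFrameExistsL : LiaFrameExistsL :=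
  Summit.NavierStokesRegularity.NavierStokesRegularity.Theorems.SkeletonJ1RFrame.stub_liaFrameExistsL

/-- STUB F2-B · `stub_liaDefectBL` · DISCHARGED BY NAME (reshape 4, lead g2): the switched normal defect of the LIA reference is
`O((√Γ + |τ|)/√log Γ)` (landed `…SkeletonJ1RLiaDefectB.stub_liaDefectBL`).  No `sorry`. -/
theorem stub_liaDefectBL : LiaDefectBL :=
  Summit.NavierStokesRegularity.NavierStokesRegularity.Theorems.SkeletonJ1RFrame.stub_liaDefectBL

/-- STUB L-core · `stub_corePinningL` · L–XL · THE HARDEST AND MOST INFORMATIVE (reshape 3 of stub L): reference injectivity on the closed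
switched region `‖x_j τ‖² ≤ 2ℓ²` — the invertibility lemma for the linearised switched defect at the explicit LIA reference, Γ-uniform sup-gain
`K(datum, Rb)` (lead's analysis: `K ≍ C·log(1/Rb)`; near-kernel = tangent space of the reference family, pinned through the collar's turning layer). -/
theorem stub_corePinningL : CorePinningL := by
  sorry

/-- STUB L · `stub_referenceInjectivityL` · DISCHARGED from `stub_corePinningL` by the landed real proof `referenceInjectivityL_of_core`
(far pinning `…SkeletonJ1RFarPinning` + exit-parameter argument `…SkeletonJ1RReferenceInjectivityOfCore`).  No `sorry` of its own. -/
theorem stub_referenceInjectivityL : ReferenceInjectivityL :=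
  Summit.NavierStokesRegularity.NavierStokesRegularity.Theorems.SkeletonJ1RFrame.referenceInjectivityL_of_core stub_corePinningL

/-- STUB K-B · `stub_kantorovichClosingBL` · L–XL · Newton–Kantorovich (`NewtonKantorovich_holds`) for `I − Φ¹` at `s = 1`, fed by F1, the RATE-B
defect F2-B and L (reshape 4: `KantorovichClosingBL = LiaFrameExistsL → LiaDefectBL → ReferenceInjectivityL → FineFixedPointL`). -/
theorem stub_kantorovichClosingBL : KantorovichClosingBL := by
  sorry

/-- STUB D · `stub_flatOutputL` · DISCHARGED BY NAME (landed `…SkeletonJ1RFlatOutput`, p717964, stub-D hand ns-filament-21221-p1 g17).  No `sorry`. -/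
theorem stub_flatOutputL : FlatOutputL :=
  Summit.NavierStokesRegularity.NavierStokesRegularity.Theorems.SkeletonJ1RFrame.stub_flatOutputL

/-- The record's 13-R stub BY NAME AND SIGNATURE (piece 2 of the split of record, stmt-NavierStokesRegularity-23612; unchanged by this line, shared
with every registered/published line of this crux). -/
theorem stub_clause13R :
    Summit.NavierStokesRegularity.NavierStokesRegularity.Theses.FilamentSkeletonRss.Clause13RNearStraightL := by
  sorry

/-- Piece 3 of the split of record — DISCHARGED BY NAME: `NormalBlockMatchedL` (stmt-23322) is a theorem in the tree (p667604). No `sorry`. -/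
theorem normalBlockL_landed :
    Summit.NavierStokesRegularity.NavierStokesRegularity.Theses.FilamentSkeletonRss.NormalBlockMatchedL :=
  Summit.NavierStokesRegularity.NavierStokesRegularity.Theorems.FilamentSkeletonRssNormalBlockMatchedL.stub_normalBlockL

/-! ## §5 Composition (REAL proofs, no stub constant used until `SkeletonJ1R_of`) -/

/-- The heart's content from the four stub STATEMENTS (modus ponens; recorded so that the seam F1/F2-B/L ⟶ K-B is kernel-visible). -/
theorem fineFixedPointL_of (hF1 : LiaFrameExistsL) (hF2 : LiaDefectBL) (hL : ReferenceInjectivityL) (hK : KantorovichClosingBL) :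
    FineFixedPointL :=
  hK hF1 hF2 hL

/-- COMPOSITION over the five stub STATEMENTS: the frame (F1) at every `Γ ≥ Γ₁`, the Kantorovich fixed point (K, fed by F1, F2 and L) in that very
frame, booked by (D) at `λ = 1`.  Constants threaded: `Rb₁ := min Rb₁ᴰ (min Rb₁ᶠ Rb₁ᴷ)`, `Γ₂ := max Γ₁ᶠ (max Γ₂ᴷ Γ₃ᴰ)`. -/
theorem tangentSkeletonNearStraightLS_of (hF1 : LiaFrameExistsL) (hF2 : LiaDefectBL) (hL : ReferenceInjectivityL) (hK : KantorovichClosingBL)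
    (hD : FlatOutputL) : TangentSkeletonNearStraightLS := by
  intro N δd ρd Λd Rwd θd mw p t γ α s₀ hN hδ hρ hRw hθ hmw hSD hGP
  obtain ⟨δ, ρ, K, Λ, Rw, cg, θ₀, KA, RbD, hδ', hρ', hRw', hcg, hθ₀', hRbD, hKρ, hDfam⟩ :=
    hD N δd ρd Λd Rwd θd mw p t γ α s₀ hN hδ hρ hRw hθ hmw hSD hGP
  obtain ⟨RbF, hRbF, hFfam⟩ := hF1 N δd ρd Λd Rwd θd mw p t γ α s₀ hN hδ hρ hRw hθ hmw hSD hGP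
  obtain ⟨RbK, hRbK, hKfam⟩ := (fineFixedPointL_of hF1 hF2 hL hK) N δd ρd Λd Rwd θd mw p t γ α s₀ hN hδ hρ hRw hθ hmw hSD hGP
  refine ⟨δ, ρ, K, Λ, Rw, cg, θ₀, KA, min RbD (min RbF RbK), hδ', hρ', hRw', hcg, hθ₀',
    lt_min hRbD (lt_min hRbF hRbK), hKρ, ?_⟩
  intro Rb hRb hRb₁
  have hRbD' : Rb ≤ RbD := le_trans hRb₁ (min_le_left _ _)
  have hRbF' : Rb ≤ RbF := le_trans hRb₁ (le_trans (min_le_right _ _) (min_le_left _ _))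
  have hRbK' : Rb ≤ RbK := le_trans hRb₁ (le_trans (min_le_right _ _) (min_le_right _ _))
  obtain ⟨Γ₁, hframe⟩ := hFfam Rb hRb hRbF'
  obtain ⟨Γ₂, hfix⟩ := hKfam Rb hRb hRbK'
  obtain ⟨Γ₃, hout⟩ := hDfam 1 Rb one_pos hRb hRbD'
  refine ⟨max Γ₁ (max Γ₂ Γ₃), fun Γ hΓ => ?_⟩
  have hΓ₁ : Γ₁ ≤ Γ := le_trans (le_max_left _ _) hΓ
  have hΓ₂ : Γ₂ ≤ Γ := le_trans (le_trans (le_max_left _ _) (le_max_right _ _)) hΓ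
  have hΓ₃ : Γ₃ ≤ Γ := le_trans (le_trans (le_max_right _ _) (le_max_right _ _)) hΓ
  obtain ⟨x, M, hx, hxM⟩ := hframe Γ hΓ₁
  obtain ⟨X, hfine, htan, hreg⟩ := hfix Γ hΓ₂ x M hx hxM
  obtain ⟨w, c, Aa, hflat, hns⟩ := hout Γ hΓ₃ x M hxM X hfine htan hreg
  exact ⟨X, w, c, Aa, hflat, hns⟩

/-- The child of record `TangentSkeletonNearStraightL` (stmt-NavierStokesRegularity-23320, the heart) from the four stub statements — by the landed
certificate `route_tangentSkeletonNearStraightL_iff` (`Iff.rfl`).  Real proof. -/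
theorem tangentSkeletonNearStraightL_of_hyps (hF1 : LiaFrameExistsL) (hF2 : LiaDefectBL) (hL : ReferenceInjectivityL) (hK : KantorovichClosingBL)
    (hD : FlatOutputL) : Summit.NavierStokesRegularity.NavierStokesRegularity.Theses.FilamentSkeletonRss.TangentSkeletonNearStraightL :=
  route_tangentSkeletonNearStraightL_iff.mpr (tangentSkeletonNearStraightLS_of hF1 hF2 hL hK hD)

/-- **THE SKELETON THEOREM — the crux `FilamentSkeletonRss.SkeletonJ1R` (stmt-NavierStokesRegularity-23610) BY NAME**, through the LANDED split glue
`skeletonJ1R_of_children` (p673130): heart from the frame-existence / defect / injectivity / Kantorovich / output stubs, 13-R from the shared record stub, normal block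
landed, F1, D and F2-B landed.  Closed modulo the three stub `sorry`s only (L-core, K-B, 13R). -/
theorem SkeletonJ1R_of : Summit.NavierStokesRegularity.NavierStokesRegularity.Theses.FilamentSkeletonRss.SkeletonJ1R :=
  Summit.NavierStokesRegularity.NavierStokesRegularity.Theorems.FilamentSkeletonRssSkeletonJ1RSplit.skeletonJ1R_of_children
    (tangentSkeletonNearStraightL_of_hyps StreamlineKantorovichR.stub_liaFrameExistsL StreamlineKantorovichR.stub_liaDefectBL stub_referenceInjectivityL
      stub_kantorovichClosingBL StreamlineKantorovichR.stub_flatOutputL)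
    stub_clause13R normalBlockL_landed

end Summit.NavierStokesRegularity.NavierStokesRegularity.Cruxes.SkeletonJ1R.StreamlineKantorovichR

end
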